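import Mathlib.Analysis.Complex.Circle
import Mathlib.Analysis.Complex.Polynomial.Basic
import Mathlib.Data.ZMod.QuotientGroup
import Mathlib.RingTheory.RootsOfUnity.Complex
import Mathlib.Topology.Algebra.Constructions
import Literature.AlgebraicGeometry.Frobenioids.NumberFieldLocalizationCategories
import Literature.AlgebraicGeometry.Frobenioids.BCatOrbitsAnyTopology
import HarnessLib

/-!
# Frobenioids II, Example 1.4 (ii): "`E₀ → P₀` is arrow-wise essentially surjective" — its universal
# closure over ALL topologized groups `G ⊇ D` is REFUTED (witness `(ℂˣ, {±1})`) — PROOF-ONLY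

Mochizuki, *The geometry of Frobenioids II: poly-Frobenioids*, Kyushu J. Math. **62** (2008)
401–460, §1 Example 1.4 (ii), author's text p. 13 [cite: MochizukiFrdII2008, Ex. 1.4 (ii) p.13];
base category `B(G)` of [FrdI] §0 p. 13 [cite: MochizukiFrdI2008, §0 p.13].

abc-iut cell, FACT-LIST wave F (seat f-044, tranche 44), row **F-1172** `NFLocCat.ToP₀ArrowwiseEssSurj
(G) [Group G] [TopologicalSpace G] (D : Subgroup G)` (`NumberFieldLocalizationCategories.lean`, seat
abc-iut-L1-t8).  In print `G = Gal(F̃/F)` is PROFINITE and `D = D_v`; the tree's witness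
`NFLocCat.toP₀ArrowwiseEssSurj_holds` (`NumberFieldLocalizationCategoriesFSMFF.lean`) proves the claim
for `G` compact and totally disconnected, which is the instance form every consumer uses, so the row is
labelled *conditional*.  This file records the kernel event classifying the row (R5): the universal
closure over all `(G, D)` is FALSE — profiniteness is used in earnest.

Countermodel (not in the paper; elementary): `G = ℂˣ` with its usual topology (a topological group) and
`D = μ₂ = {±1}`.  Every subgroup of finite index of the divisible group `ℂˣ` is all of `ℂˣ`
(`u = v^n` for every unit `u`, `ℂ` being algebraically closed), so a connected object of `B(ℂˣ)` — a
single orbit with open stabilisers of finite index — is a single POINT; the structure arrow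
`ι : P ↪ Q|_D` of an object `(P, Q, ι)` of `E₀` is injective, so every object in the image of
`E₀ → P₀` has exactly one point.  But `D = {±1}` is discrete (finite in a Hausdorff group), so its
regular representation is a connected object of `P₀ = B(D)⁰` with two points, and its identity arrow
is not abstractly equivalent to the image of any arrow of `E₀`.  A refuted universal closure says the
row is a hypothesis on data (here: on the topology of `G`), not that anything in print is false; no
statement of the paper is strengthened; nothing here takes a side on [IUTchIII] Cor. 3.12.
-/

namespace Literature.AlgebraicGeometry.Frobenioids

namespace NFLocCat

open CategoryTheory
open scoped FintypeCatDiscrete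

/-- In the divisible group `ℂˣ` every subgroup of finite index is everything: a unit `u` is an
`n`-th power for every `n ≥ 1` (`ℂ` algebraically closed), and `v ^ [ℂˣ : U] ∈ U`.
[cite: MochizukiFrdII2008, Ex. 1.4 (ii) p.13] -/
theorem subgroup_units_complex_eq_top_of_finiteIndex (U : Subgroup ℂˣ) [U.FiniteIndex] : U = ⊤ := by
  rw [eq_top_iff]
  intro u _
  have hn : 0 < U.index := Nat.pos_of_ne_zero Subgroup.FiniteIndex.index_ne_zero
  obtain ⟨z, hz⟩ := IsAlgClosed.exists_pow_nat_eq (u : ℂ) hn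
  have hz0 : z ≠ 0 := by
    intro h0
    apply u.ne_zero
    rw [← hz, h0, zero_pow hn.ne']
  have hv : Units.mk0 z hz0 ^ U.index = u := Units.ext (by simp [hz])
  rw [← hv]
  exact U.pow_index_mem (Units.mk0 z hz0)

/-- Hence a connected object of `B(ℂˣ)` ([FrdI] §0: a single orbit whose stabilisers are open of finite
index) is a single point. [cite: MochizukiFrdI2008, §0 p.15] -/
theorem subsingleton_of_isConnectedObj_units_complex (Q : BCat ℂˣ) (hQ : IsConnectedObj Q)
    (q q' : Q.obj.V) : q = q' := by
  obtain ⟨u, hu⟩ := BCat.exists_smul_eq_of_isConnectedObj' Q hQ q q'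
  haveI := BCat.finiteIndex_stabilizer Q q
  have hmem : u ∈ MulAction.stabilizer ℂˣ q := by
    rw [subgroup_units_complex_eq_top_of_finiteIndex (MulAction.stabilizer ℂˣ q)]
    exact Subgroup.mem_top u
  rw [← hu]
  exact (MulAction.mem_stabilizer_iff.mp hmem).symm

/-- **F-1172 REFUTED at the instance `(G, D) = (ℂˣ, μ₂)`**: for the topological group `ℂˣ` and its
subgroup `{±1}` the functor `E₀ → P₀` of FrdII Ex. 1.4 is NOT arrow-wise essentially surjective (every
object in its image has one point, while the regular `{±1}`-set is a two-point object of `P₀`).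
[cite: MochizukiFrdII2008, Ex. 1.4 (ii) p.13] -/
theorem not_toP₀ArrowwiseEssSurj_units_complex :
    ¬ Literature.AlgebraicGeometry.Frobenioids.NFLocCat.ToP₀ArrowwiseEssSurj ℂˣ (rootsOfUnity 2 ℂ) := by
  intro h
  -- `D = μ₂ = {±1}`: finite, hence discrete in the Hausdorff group `ℂˣ`, and nontrivial
  let D : Subgroup ℂˣ := rootsOfUnity 2 ℂ
  have hm1 : (-1 : ℂˣ) ∈ D := by
    rw [mem_rootsOfUnity]
    exact neg_one_sq
  let m : D := ⟨-1, hm1⟩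
  have hm : m ≠ 1 := by
    intro e
    have e' := congrArg (fun v : D => ((v : ℂˣ) : ℂ)) e
    change ((-1 : ℂˣ) : ℂ) = ((1 : ℂˣ) : ℂ) at e'
    norm_num at e'
  haveI : DiscreteTopology D := inferInstance
  -- (1) every object of `E₀` has a one-point `P`-component
  have one : ∀ (T : ECat ℂˣ D) (a b : T.obj.left.obj.obj.V), a = b := by
    intro T a b
    haveI : Mono T.obj.hom := T.property
    apply BCat.injective_of_mono' T.obj.hom
    exact subsingleton_of_isConnectedObj_units_complex T.obj.right.obj T.obj.right.property _ _
  -- (2) the regular `D`-set: a connected object of `P₀` with the two points `1 ≠ -1`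
  let PA : Action FintypeCat.{0} D := Action.FintypeCat.ofMulAction D (FintypeCat.of D)
  have hPA : Action.IsContinuous PA :=
    (BCat.isContinuous_iff_isOpen_setOf_smul_eq PA).mpr fun _ _ => isOpen_discrete _
  let P : BCat D := ⟨PA, hPA⟩
  have hP : IsConnectedObj P :=
    BCat.isConnectedObj_of_transitive' P (1 : D) fun x => ⟨x, by
      change ConcreteCategory.hom (PA.ρ x) (1 : D) = x
      rw [Action.FintypeCat.ofMulAction_apply, smul_eq_mul, mul_one]⟩
  let X : PCat ℂˣ D := ⟨P, hP⟩
  -- (3) the identity of `X` is not abstractly equivalent to the image of an arrow of `E₀`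
  obtain ⟨A, B, f, ⟨e⟩⟩ := h (𝟙 X)
  let eL : (toP₀ ℂˣ D).obj A ≅ X := Arrow.leftFunc.mapIso e
  let eB : A.obj.left.obj ≅ P := (connectedObjects (BCat D)).ι.mapIso eL
  have hsurj := (BCat.bijective_of_isIso eB.hom).2
  obtain ⟨a, ha⟩ := hsurj (1 : D)
  obtain ⟨b, hb⟩ := hsurj m
  have hab : a = b := one A a b
  rw [hab, hb] at ha
  exact hm ha

/-- **F-1172: the universal closure of the named fact `NFLocCat.ToP₀ArrowwiseEssSurj` — "`E₀ → P₀` is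
arrow-wise essentially surjective" for EVERY group `G` with a topology and every subgroup `D` — is
FALSE** (witness `(ℂˣ, μ₂)`; in print `G = Gal(F̃/F)` is profinite, and the instance form for compact
totally disconnected `G` is the tree's `NFLocCat.toP₀ArrowwiseEssSurj_holds`).
[cite: MochizukiFrdII2008, Ex. 1.4 (ii) p.13] -/
theorem not_forall_toP₀ArrowwiseEssSurj :
    ¬ ∀ (G : Type) [Group G] [TopologicalSpace G] (D : Subgroup G),
        Literature.AlgebraicGeometry.Frobenioids.NFLocCat.ToP₀ArrowwiseEssSurj G D :=
  fun h => not_toP₀ArrowwiseEssSurj_units_complex (h ℂˣ (rootsOfUnity 2 ℂ))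

/-! ### v2 (append-only; the declarations above are byte-identical to v1 p429643): tightness of the
instance form — COMPACTNESS ALONE DOES NOT SUFFICE (`S¹ ⊇ {±1}`), via a general divisible-group lemma

`NFLocCat.toP₀ArrowwiseEssSurj_holds` assumes `[IsTopologicalGroup G] [CompactSpace G]
[TotallyDisconnectedSpace G]`.  The witness `(ℂˣ, μ₂)` above is neither compact nor totally disconnected.
Below: (1) a general lemma — if every subgroup of finite index of `G` is all of `G` (e.g. `G` divisible)
then for every FINITE, DISCRETE, NONTRIVIAL subgroup `D` the functor `E₀ → P₀` is not arrow-wise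
essentially surjective (its image consists of one-point objects, while the regular `D`-set is a
connected object of `P₀` with `|D| ≥ 2` points); (2) the instance `G = S¹` (the unit circle of `ℂ`, a
COMPACT connected topological group; divisible because `ℂ` is algebraically closed and `|z^n| = |z|^n`),
`D = {±1}`: so `TotallyDisconnectedSpace G` is NOT an idle hypothesis of the instance form.  (That
`CompactSpace G` is not idle either is witnessed by any divisible DISCRETE group with torsion, e.g.
`ℚ/ℤ ⊇ ½ℤ/ℤ`; not formalised here.)  PROOF-ONLY; nothing here bears on [IUTchIII] Cor. 3.12. -/

universe u

/-- **General obstruction.**  If every finite-index subgroup of `G` is `⊤` (no hypothesis on the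
topology), then for a finite nontrivial subgroup `D` whose induced topology is discrete, `E₀ → P₀` is not
arrow-wise essentially surjective: connected objects of `B(G)` are points, so every object in the image
has one point (`ι` is injective), but the regular representation of `D` is a connected object of
`P₀ = B(D)⁰` with two distinct points `1 ≠ m`. [cite: MochizukiFrdII2008, Ex. 1.4 (ii) p.13] -/
theorem not_toP₀ArrowwiseEssSurj_of_forall_finiteIndex_eq_top {G : Type u} [Group G]
    [TopologicalSpace G] (hG : ∀ U : Subgroup G, U.FiniteIndex → U = ⊤) (D : Subgroup G)
    [Finite D] [DiscreteTopology D] (m : D) (hm : m ≠ 1) :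
    ¬ Literature.AlgebraicGeometry.Frobenioids.NFLocCat.ToP₀ArrowwiseEssSurj G D := by
  intro h
  haveI : Fintype D := Fintype.ofFinite D
  -- connected objects of `B(G)` are single points
  have pt : ∀ (Q : BCat G), IsConnectedObj Q → ∀ q q' : Q.obj.V, q = q' := by
    intro Q hQ q q'
    obtain ⟨u, hu⟩ := BCat.exists_smul_eq_of_isConnectedObj' Q hQ q q'
    have hmem : u ∈ MulAction.stabilizer G q := by
      rw [hG _ (BCat.finiteIndex_stabilizer Q q)]
      exact Subgroup.mem_top u
    rw [← hu]
    exact (MulAction.mem_stabilizer_iff.mp hmem).symm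
  -- (1) every object of `E₀` has a one-point `P`-component
  have one : ∀ (T : ECat G D) (a b : T.obj.left.obj.obj.V), a = b := by
    intro T a b
    haveI : Mono T.obj.hom := T.property
    apply BCat.injective_of_mono' T.obj.hom
    exact pt T.obj.right.obj T.obj.right.property _ _
  -- (2) the regular `D`-set: a connected object of `P₀` with the two points `1 ≠ m`
  let PA : Action FintypeCat.{u} D := Action.FintypeCat.ofMulAction D (FintypeCat.of D)
  have hPA : Action.IsContinuous PA :=
    (BCat.isContinuous_iff_isOpen_setOf_smul_eq PA).mpr fun _ _ => isOpen_discrete _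
  let P : BCat D := ⟨PA, hPA⟩
  have hP : IsConnectedObj P :=
    BCat.isConnectedObj_of_transitive' P (1 : D) fun x => ⟨x, by
      change ConcreteCategory.hom (PA.ρ x) (1 : D) = x
      rw [Action.FintypeCat.ofMulAction_apply, smul_eq_mul, mul_one]⟩
  let X : PCat G D := ⟨P, hP⟩
  -- (3) the identity of `X` is not abstractly equivalent to the image of an arrow of `E₀`
  obtain ⟨A, B, f, ⟨e⟩⟩ := h (𝟙 X)
  let eL : (toP₀ G D).obj A ≅ X := Arrow.leftFunc.mapIso e
  let eB : A.obj.left.obj ≅ P := (connectedObjects (BCat D)).ι.mapIso eL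
  have hsurj := (BCat.bijective_of_isIso eB.hom).2
  obtain ⟨a, ha⟩ := hsurj (1 : D)
  obtain ⟨b, hb⟩ := hsurj m
  have hab : a = b := one A a b
  rw [hab, hb] at ha
  exact hm ha

/-- In the compact group `S¹ ⊆ ℂ` every subgroup of finite index is everything: `S¹` is divisible
(an `n`-th root in `ℂ` of a point of `S¹` lies on `S¹`). [cite: MochizukiFrdII2008, Ex. 1.4 (ii) p.13] -/
theorem subgroup_circle_eq_top_of_finiteIndex (U : Subgroup Circle) [U.FiniteIndex] : U = ⊤ := by
  rw [eq_top_iff]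
  intro u _
  have hn : 0 < U.index := Nat.pos_of_ne_zero Subgroup.FiniteIndex.index_ne_zero
  obtain ⟨z, hz⟩ := IsAlgClosed.exists_pow_nat_eq (u : ℂ) hn
  have hz1 : ‖z‖ = 1 := by
    have h1 : ‖z‖ ^ U.index = 1 := by rw [← norm_pow, hz, Circle.norm_coe]
    exact (pow_eq_one_iff_of_nonneg (norm_nonneg z) hn.ne').mp h1
  let v : Circle := ⟨z, mem_sphere_zero_iff_norm.2 hz1⟩
  have hv : v ^ U.index = u := Circle.ext (by rw [Circle.coe_pow]; exact hz)
  rw [← hv]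
  exact U.pow_index_mem v

/-- **Tightness of the instance form at a COMPACT topological group**: for `G = S¹` (compact, connected,
hence not totally disconnected) and `D = {±1}`, `E₀ → P₀` is NOT arrow-wise essentially surjective — the
hypothesis `TotallyDisconnectedSpace G` of `NFLocCat.toP₀ArrowwiseEssSurj_holds` (profinite
`G = Gal(F̃/F)` in print) is not idle. [cite: MochizukiFrdII2008, Ex. 1.4 (ii) p.13] -/
theorem not_toP₀ArrowwiseEssSurj_circle :
    ¬ Literature.AlgebraicGeometry.Frobenioids.NFLocCat.ToP₀ArrowwiseEssSurj Circle
        (Subgroup.zpowers (-1 : Circle)) := by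
  have hfin : IsOfFinOrder (-1 : Circle) := isOfFinOrder_iff_pow_eq_one.mpr ⟨2, two_pos, neg_one_sq⟩
  haveI : Finite (Subgroup.zpowers (-1 : Circle)) := hfin.finite_zpowers.to_subtype
  refine not_toP₀ArrowwiseEssSurj_of_forall_finiteIndex_eq_top
    (fun U hU => subgroup_circle_eq_top_of_finiteIndex U) (Subgroup.zpowers (-1 : Circle))
    ⟨-1, Subgroup.mem_zpowers _⟩ fun e => Circle.neg_ne_self 1 (congrArg Subtype.val e)

end NFLocCat

end Literature.AlgebraicGeometry.Frobenioids
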